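import Literature.ModelTheory.PseudofiniteFields.EtaleImagePullback

/-!
# Stub W7 of line LonelyTranslates (c1): cylinders over étale images are étale images

Crux `PairwiseCurvedTilingsLC` (route DefinableSTPPDichotomy, stmt-MatrixMultiplication-17883),
negative line LonelyTranslates, continuation c1 ("Prop27Reduction").  The registered stub
`stub_etaleImage_pullback` is the case of a coordinate embedding `ι : Fin m' ↪ Fin m` of
`Literature/ModelTheory/PseudofiniteFields/EtaleImagePullback.lean`
(`EtaleDatum.exists_image_eq_preimage_comp`, valid for any map `ι` over any commutative ring):
the preimage of the image of a standard étale datum over `K^{m'}` under `x ↦ x ∘ ι` is the image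
of the datum with renamed set variables `X_i ↦ X_{ι i}`.  It is consumed by the chart induction
(`stub_openPiece`) of the skeleton.
-/

set_option linter.dupNamespace false  -- `Summit.<S>.<S>.…` is the mandated namespace

namespace Summit.MatrixMultiplication.MatrixMultiplication.Theorems.PairwiseCurvedTilingsLC.Negative

open FirstOrder FirstOrder.Language FirstOrder.Ring
open Literature.ModelTheory.PseudofiniteFields

/-- STUB (helper W7): the pull-back of a basic étale-open set along a coordinate projection
`K^m → K^{m'}`, `x ↦ x ∘ ι`, is a basic étale-open set (with the same number of auxiliary
variables): rename the set variables of the datum along `ι`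
(`EtaleDatum.exists_image_eq_preimage_comp`). -/
theorem stub_etaleImage_pullback {K : Type} [Field K] {m m' r : ℕ} (ι : Fin m' ↪ Fin m)
    (E : EtaleDatum K m' r) :
    ∃ E' : EtaleDatum K m r, E'.image = {x | (x ∘ ι) ∈ E.image} :=
  E.exists_image_eq_preimage_comp ι

end Summit.MatrixMultiplication.MatrixMultiplication.Theorems.PairwiseCurvedTilingsLC.Negative
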